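import Literature.AnabelianGeometry.SemiGraphs.SectionFibreSaturation
import Literature.AnabelianGeometry.SemiGraphs.SubgraphComponentsDoubleCosetsOfRestrictSurjective
import Literature.AnabelianGeometry.SemiGraphs.TieBranchClause
import Literature.AnabelianGeometry.SemiGraphs.VertexAlignedStabilizers
import Literature.AnabelianGeometry.SemiGraphs.FiniteEtaleCoveringDictionaryProofs2b
import Literature.AnabelianGeometry.Anabelioids.Pi1RangeOrbitCriterion
import HarnessLib

/-!
# (D3) `covering_subgraphComponents_doubleCosets` for every BRANCH-ALIGNED covering ([SemiAnbd] Cor. 2.7 (i) p. 30)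

Mochizuki, *Semi-graphs of anabelioids*, Publ. RIMS **42** (2006), §2, proof of Cor. 2.7 (i) p. 30
("`ℋ′` injects into `𝒢′` as a subgraph": along the finite étale covering `𝒢′ → 𝒢` attached to `A`,
the preimage components of a connected sub-graph `ℍ` ARE the coverings of `𝒢_ℍ` attached to the
components of `A|_ℍ`) [cite: MochizukiSemiAnbd2006, Cor. 2.7(i) p.30]; Def. 2.2 (i) p. 23 (print's
morphisms include branch alignment), Rem. 2.2.1 p. 24.

PROOF-ONLY (abc-iut cell, layer L3, gap row G-L3-R1-E3, abc-iut-L3-d3; FACT-LIST row F-1487 at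
print's notion).  abc-iut-L3-d3's `covering_subgraphComponents_doubleCosets_of_restrictSurjective`
reduced the dictionary fact (D3) for an ABSTRACT covering to ONE inclusion (Surj)
«`Stab_{Π_ℍ}(x) ≤ ι_ψ(Π_K)`» — the `π₁`-surjectivity of the restricted covering `𝒢′|_K → 𝒢|_ℍ` onto
the decomposition stabiliser.  This file PROVES (Surj) for every covering in print's four-clause sense
(local ∧ global ∧ vertex-aligned ∧ BRANCH-ALIGNED):

* `Hom.stabilizer_le_range_restrict_of_isBranchAligned` — (Surj): the sheet argument for section
  fibres (`Hom.sectionFibres_saturate`, abc-iut-L3-d3) fed with the TIE labels of abc-iut-f-161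
  (`Hom.tie_localLabels`: the components holding the global base points label the vertices/edges of
  `𝒢′` bijectively, compatibly with abutment) and vertex alignment at every section point
  (abc-iut-w4-d079's `IsVertexAligned.stabilizer_eq_of_ranges`) shows that `Π_K` acts transitively on
  the section fibres of every connected `Y ∈ B(𝒢_ℍ)`; the orbit criterion
  `stabilizer_le_range_of_forall_connected` then puts `Stab_{Π_ℍ}(x)` inside `ι_ψ(Π_K)`;
* `covering_subgraphComponents_doubleCosets_of_isBranchAligned` — **(D3), all four clauses, for every
  connected `𝒢`, `𝒢′` and every `φ : 𝒢′ → 𝒢` which is locally and globally the covering attached to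
  `A`, vertex-aligned AND branch-aligned** (= F-1487 at print's notion of morphism; the typed F-1487,
  which omits branch alignment, stays conditional — abc-iut-L3-d3 SHAPES-F1487/SHAPES-R1: non-aligned
  "exotic" coverings exist and need the Bass–Serre core rigidity instead).

No definition, no new named fact; nothing here takes a side on [IUTchIII] Cor. 3.12.
-/

namespace Literature.AnabelianGeometry.SemiGraphs

namespace SemiGraphOfAnabelioids

open CategoryTheory CategoryTheory.Limits CategoryTheory.Functor CategoryTheory.PreGaloisCategory
open Literature.AnabelianGeometry.Anabelioids
open scoped Pointwise

universe v₁ u₁ u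

variable {𝒢 𝒢' : SemiGraphOfAnabelioids.{v₁, u₁, u}}

/-- Transport along an isomorphism of basepoints commutes with the actions on fibres.
[cite: MochizukiGeoAn2004, §1.1 p.10] -/
private theorem autMulEquivOfIso_smul_hom_app₃ {C : Type*} [Category C] {Φ₁ Φ₂ : C ⥤ FintypeCat.{v₁}}
    (e : Φ₁ ≅ Φ₂) (X : C) (σ : Aut Φ₁) (x : Φ₁.obj X) :
    Aut.autMulEquivOfIso e σ • e.hom.app X x = e.hom.app X (σ • x) := by
  rw [mulAction_def, mulAction_def]
  change (e.inv ≫ σ.hom ≫ e.hom).app X (e.hom.app X x) = _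
  simp only [NatTrans.comp_app, FintypeCat.comp_apply]
  rw [← FintypeCat.comp_apply (e.hom.app X) (e.inv.app X), ← NatTrans.comp_app, e.hom_inv_id,
    NatTrans.id_app, FintypeCat.id_apply]

/-- **(Surj) for branch-aligned coverings** ([SemiAnbd] p. 30, "`ℋ′` injects into `𝒢′`"): for
connected `𝒢`, `𝒢′`, a morphism `φ : 𝒢′ → 𝒢` which is locally and globally the covering attached to `A`,
vertex-aligned and branch-aligned, a connected sub-graph `ℍ`, a preimage component `K`, a vertex
`w″ ∈ K` over `u`, constituent basepoints `(F″, F₂, e₂)` and a point `x` of the fibre `F₂(A_u)` fixed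
by the decomposition group `ι″(Π_{𝒢′})`: the stabiliser `Stab_{Π_ℍ}(x)` is contained in the image
`ι_ψ(Π_K)` of the restricted morphism `ψ := φ|_K : 𝒢′|_K → 𝒢|_ℍ`.
[cite: MochizukiSemiAnbd2006, Cor. 2.7(i) p.30] -/
theorem Hom.stabilizer_le_range_restrict_of_isBranchAligned (φ : Hom 𝒢' 𝒢) (A : 𝒢.BObj)
    (h𝒢 : 𝒢.IsConnected) (h𝒢' : 𝒢'.IsConnected) (hloc : φ.IsFiniteEtaleCoveringOf A)
    (hB : φ.IsGlobalCoveringOf A) (hva : φ.IsVertexAligned) (hal : φ.IsBranchAligned)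
    (H : 𝒢.graph.Subgraph) (hH : H.toSemiGraph.IsConnected) (hHg : H.toSemiGraph.IsGraph)
    (K : {K : 𝒢'.graph.Subgraph // φ.IsPreimageComponent H K})
    (w'' : K.1.toSemiGraph.Vertex) (F'' : 𝒢'.V w''.1 ⥤ FintypeCat.{v₁}) [FiberFunctor F'']
    (F₂ : 𝒢.V (φ.base.vertexMap w''.1) ⥤ FintypeCat.{v₁}) [FiberFunctor F₂]
    (e₂ : (φ.φV w''.1).pullback ⋙ F'' ≅ F₂)
    (x : (𝒢.ρ (φ.base.vertexMap w''.1) ⋙ F₂).obj A)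
    (hx : ((Aut.autMulEquivOfIso (isoWhiskerLeft (𝒢.ρ (φ.base.vertexMap w''.1)) e₂)
          ).toMonoidHom.comp (pi1Map φ.pullbackFunctor (𝒢'.ρ w''.1 ⋙ F''))).range ≤
        MulAction.stabilizer (𝒢.Pi (φ.base.vertexMap w''.1) F₂) x) :
    MulAction.stabilizer (𝒢.PiH H ⟨φ.base.vertexMap w''.1, K.2.2.2.2.1 w''.2⟩ F₂)
        (show ((𝒢.restrict H).ρ ⟨φ.base.vertexMap w''.1, K.2.2.2.2.1 w''.2⟩ ⋙ F₂).obj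
          ((𝒢.restrictFunctor H).obj A) from x) ≤
      ((Aut.autMulEquivOfIso
            (isoWhiskerLeft ((𝒢.restrict H).ρ ⟨φ.base.vertexMap w''.1, K.2.2.2.2.1 w''.2⟩)
              e₂)).toMonoidHom.comp
          (pi1Map (φ.restrict K.1 H K.2.2.2.2.1 K.2.2.2.2.2.1).pullbackFunctor
            ((𝒢'.restrict K.1).ρ w'' ⋙ F''))).range := by
  have hKV : K.1.verts ⊆ φ.base.vertexMap ⁻¹' H.verts := K.2.2.2.2.1
  have hKE : K.1.edges ⊆ φ.base.edgeMap ⁻¹' H.edges := K.2.2.2.2.2.1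
  have hBc := hB
  obtain ⟨hprod, α, hα, ⟨eB⟩⟩ := hB
  haveI := hprod
  haveI := hα
  -- the global terminal object and the tautological section
  let T : 𝒢'.BObj := α.obj (Over.mk (𝟙 A))
  have hT : IsTerminal T := Over.mkIdTerminal.isTerminalObj α _
  have hTV : ∀ v', IsTerminal (T.S v') := fun v' => by
    haveI := preservesTerminal_ρ 𝒢' v'
    exact hT.isTerminalObj (𝒢'.ρ v') _
  have hTE : ∀ e', IsTerminal (T.T e') := fun e' => by
    haveI := (𝒢'.hasLimitsOfShape_bObj (J := Discrete PEmpty.{1})).2.2 e'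
    exact hT.isTerminalObj (𝒢'.ρE e') _
  let s : T ⟶ φ.pullbackFunctor.obj A :=
    α.map ((Over.forgetAdjStar A).unit.app (Over.mk (𝟙 A))) ≫ eB.inv.app A
  -- the TIE labels (abc-iut-f-161)
  obtain ⟨O, OE, hO, hOE, hOiff, hOEiff, hbr⟩ := φ.tie_localLabels A α eB hloc hal hva h𝒢' h𝒢
  have hsV : ∀ v', ∃ k : T.S v' ⟶ (φ.φV v').pullback.obj (O v').1,
      k ≫ (φ.φV v').pullback.map (O v').1.arrow = s.fS v' := fun v' => (hOiff v' (O v')).mp rfl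
  have hsE : ∀ e', ∃ k : T.T e' ⟶ (φ.φE e' (φ.base.edgeMap e') rfl).pullback.obj (OE e').1,
      k ≫ (φ.φE e' (φ.base.edgeMap e') rfl).pullback.map (OE e').1.arrow = s.fT e' :=
    fun e' => (hOEiff e' (OE e')).mp rfl
  -- vertex alignment at the section points
  obtain ⟨hprop, cV, cE, -, -, hlocV, -, -⟩ := hloc
  have hVAK : ∀ (w : 𝒢'.graph.Vertex) (_ : w ∈ K.1.verts) (F' : 𝒢'.V w ⥤ FintypeCat.{v₁})
      [FiberFunctor F'] (F : 𝒢.V (φ.base.vertexMap w) ⥤ FintypeCat.{v₁}) [FiberFunctor F]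
      (e : (φ.φV w).pullback ⋙ F' ≅ F) (t : F'.obj (T.S w)),
      MulAction.stabilizer (Aut F) (e.hom.app (A.S (φ.base.vertexMap w)) (F'.map (s.fS w) t)) ≤
        ((Aut.autMulEquivOfIso e).toMonoidHom.comp (pi1Map (φ.φV w).pullback F')).range := by
    intro w _ F' _ F _ e t
    -- the global base point: `range ι = Stab_{Π_𝒢}(a₀)`
    haveI : PreservesLimitsOfShape WalkingCospan (𝒢'.ρ w) := preservesPullbacks_ρ 𝒢' w
    haveI : PreservesLimitsOfShape (Discrete PEmpty.{1}) (𝒢'.ρ w) := preservesTerminal_ρ 𝒢' w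
    haveI : PreservesLimitsOfShape WalkingCospan (𝒢'.ρ w ⋙ F') := inferInstance
    haveI : (𝒢'.ρ w ⋙ F').PreservesMonomorphisms := inferInstance
    haveI : Subsingleton ((𝒢'.ρ w ⋙ F').obj (α.obj (Over.mk (𝟙 A)))) :=
      subsingleton_fiber_of_isTerminal F' (hTV w)
    have ha := range_pi1Map_eq_stabilizer' α eB (𝒢'.ρ w ⋙ F')
      (isoWhiskerLeft (𝒢.ρ (φ.base.vertexMap w)) e) t
    -- the local base point: `range ι_w = Stab_{Π_u}(p₀)`
    obtain ⟨αw, hαw, ⟨eloc⟩⟩ := hlocV w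
    haveI := hαw
    haveI : PreservesFiniteLimits (φ.φV w).pullback := (φ.φV w).property.1
    have hTloc : IsTerminal (αw.obj (Over.mk (𝟙 (Subobject.underlying.obj (cV w).1)))) :=
      Over.mkIdTerminal.isTerminalObj αw _
    haveI : Subsingleton (F'.obj (αw.obj (Over.mk (𝟙 (Subobject.underlying.obj (cV w).1))))) :=
      subsingleton_fiber_of_isTerminal F' hTloc
    obtain ⟨t'⟩ := nonempty_fiber_of_isTerminal F' hTloc
    have hp := range_pi1Map_eq_stabilizer' αw eloc F' e t'
    have heq := hva.stabilizer_eq_of_ranges w F' F e _ ha (cV w).1.arrow _ hp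
    exact (heq.trans hp.symm).le
  -- Galois structures on `B(𝒢_ℍ)` and `B(𝒢′_K)`
  have hKc : (𝒢'.restrict K.1).IsConnected := ⟨K.2.1⟩
  letI := (𝒢.restrict H).galoisCategory_bObj ⟨hH⟩
  letI := (𝒢'.restrict K.1).galoisCategory_bObj hKc
  let uH : H.toSemiGraph.Vertex := ⟨φ.base.vertexMap w''.1, hKV w''.2⟩
  haveI : @FiberFunctor ((𝒢.restrict H).V uH) ((𝒢.restrict H).catV uH)
      ((𝒢.restrict H).galV uH).toPreGaloisCategory F₂ := ‹FiberFunctor F₂›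
  haveI : @FiberFunctor ((𝒢'.restrict K.1).V w'') ((𝒢'.restrict K.1).catV w'')
      ((𝒢'.restrict K.1).galV w'').toPreGaloisCategory F'' := ‹FiberFunctor F''›
  let FC : (𝒢.restrict H).BObj ⥤ FintypeCat.{v₁} := (𝒢.restrict H).ρ uH ⋙ F₂
  haveI : FiberFunctor FC := (𝒢.restrict H).fiberFunctor_ρ ⟨hH⟩ uH F₂
  let ψ := φ.restrict K.1 H hKV hKE
  let FD : (𝒢'.restrict K.1).BObj ⥤ FintypeCat.{v₁} := (𝒢'.restrict K.1).ρ w'' ⋙ F''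
  haveI : FiberFunctor FD := (𝒢'.restrict K.1).fiberFunctor_ρ hKc w'' F''
  let eD : ψ.pullbackFunctor ⋙ FD ≅ FC := isoWhiskerLeft ((𝒢.restrict H).ρ uH) e₂
  let Φ'' : 𝒢.V (φ.base.vertexMap w''.1) ⥤ 𝒢'.V w''.1 := (φ.φV w''.1).pullback
  -- the section point at `w″`
  haveI : Subsingleton (F''.obj (T.S w''.1)) := subsingleton_fiber_of_isTerminal F'' (hTV _)
  obtain ⟨t₀⟩ := nonempty_fiber_of_isTerminal F'' (hTV w''.1)
  let x₀ : F₂.obj (A.S (φ.base.vertexMap w''.1)) :=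
    e₂.hom.app (A.S (φ.base.vertexMap w''.1)) (F''.map (s.fS w''.1) t₀)
  -- (Surj) at the section point
  have key : MulAction.stabilizer (Aut FC) (show FC.obj ((𝒢.restrictFunctor H).obj A) from x₀) ≤
      ((Aut.autMulEquivOfIso eD).toMonoidHom.comp (pi1Map ψ.pullbackFunctor FD)).range := by
    refine stabilizer_le_range_of_forall_connected ψ.pullbackFunctor FD FC eD _ ?_
    intro Y hY g y y' hy hy'
    -- the section condition for a point over `x₀`, read on `F″`
    have hsec : ∀ z : F₂.obj (Y.S uH), F₂.map (g.fS uH) z = x₀ →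
        F''.map (Φ''.map (g.fS uH)) (e₂.inv.app (Y.S uH) z) = F''.map (s.fS w''.1) t₀ := by
      intro z hz
      have hnat := FunctorToFintypeCat.naturality F₂ (Φ'' ⋙ F'') e₂.inv (g.fS uH) z
      change (Φ'' ⋙ F'').map (g.fS uH) (e₂.inv.app (Y.S uH) z) = _
      rw [← hnat, hz]
      exact FintypeCat.hom_inv_id_apply (e₂.app (A.S (φ.base.vertexMap w''.1))) _
    let yt : FD.obj (ψ.pullbackFunctor.obj Y) := e₂.inv.app (Y.S uH) y
    let yt' : FD.obj (ψ.pullbackFunctor.obj Y) := e₂.inv.app (Y.S uH) y'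
    obtain ⟨Wc, ω₀, hω₀⟩ := exists_component_mem_range FD yt
    have hω₀' : F''.map (Φ''.map (g.fS uH)) (F''.map ((Wc.1.arrow).fS ⟨w''.1, w''.2⟩) ω₀) =
        F''.map (s.fS w''.1) t₀ := by
      have h1 : F''.map ((Wc.1.arrow).fS ⟨w''.1, w''.2⟩) ω₀ = yt := hω₀
      rw [h1]
      exact hsec y hy
    have sat := φ.sectionFibres_saturate A H K.1 hKV hKE K.2 hprop hHg hH T hTV hTE s O OE hO.1 hOE.2
      hbr hsV hsE hVAK Y hY g Wc.1.arrow w''.1 w''.2 F'' t₀ ω₀ hω₀' w''.1 w''.2 F'' t₀ yt' (hsec y' hy')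
    -- both points lie in the connected component `Wc` of `ψ^* Y`: one orbit
    have horb : Set.range (FD.map Wc.1.arrow) = MulAction.orbit (Aut FD) yt :=
      range_map_arrow_eq_orbit FD Wc ⟨ω₀, hω₀⟩
    have hyt' : yt' ∈ MulAction.orbit (Aut FD) yt := by
      rw [← horb]
      exact sat
    obtain ⟨γ, hγ⟩ := MulAction.mem_orbit_iff.mp hyt'
    refine ⟨γ, ?_⟩
    have h1 := autMulEquivOfIso_smul_hom_app₃ eD Y (pi1Map ψ.pullbackFunctor FD γ)
      (show (ψ.pullbackFunctor ⋙ FD).obj Y from yt)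
    have h2 : eD.hom.app Y yt = y := FintypeCat.inv_hom_id_apply (e₂.app (Y.S uH)) y
    have h3 : eD.hom.app Y yt' = y' := FintypeCat.inv_hom_id_apply (e₂.app (Y.S uH)) y'
    have h4 : (pi1Map ψ.pullbackFunctor FD γ) • (show (ψ.pullbackFunctor ⋙ FD).obj Y from yt) = yt' :=
      hγ
    rw [h2, h4, h3] at h1
    exact h1
  -- transfer from the section point `x₀` to `x` (same `Π_𝒢`-stabiliser: `A` is connected)
  haveI : PreservesLimitsOfShape WalkingCospan (𝒢'.ρ w''.1) := preservesPullbacks_ρ 𝒢' w''.1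
  haveI : PreservesLimitsOfShape (Discrete PEmpty.{1}) (𝒢'.ρ w''.1) := preservesTerminal_ρ 𝒢' w''.1
  haveI : PreservesLimitsOfShape WalkingCospan (𝒢'.ρ w''.1 ⋙ F'') := inferInstance
  haveI : (𝒢'.ρ w''.1 ⋙ F'').PreservesMonomorphisms := inferInstance
  haveI : Subsingleton ((𝒢'.ρ w''.1 ⋙ F'').obj (α.obj (Over.mk (𝟙 A)))) :=
    subsingleton_fiber_of_isTerminal F'' (hTV w''.1)
  have ha'' := range_pi1Map_eq_stabilizer' α eB (𝒢'.ρ w''.1 ⋙ F'')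
    (isoWhiskerLeft (𝒢.ρ (φ.base.vertexMap w''.1)) e₂) t₀
  letI := 𝒢.galoisCategory_bObj h𝒢
  let FG : 𝒢.BObj ⥤ FintypeCat.{v₁} := 𝒢.ρ (φ.base.vertexMap w''.1) ⋙ F₂
  haveI : FiberFunctor FG := 𝒢.fiberFunctor_ρ h𝒢 _ F₂
  haveI : PreGaloisCategory.IsConnected A := isConnected_of_isGlobalCovering h𝒢' φ A hBc
  have hle : MulAction.stabilizer (Aut FG) (show FG.obj A from x₀) ≤ MulAction.stabilizer (Aut FG) x :=
    ha''.symm.le.trans hx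
  have hne : (MulAction.stabilizer (Aut FG) x).index ≠ 0 := by
    rw [MulAction.index_stabilizer_of_transitive]
    exact Nat.card_ne_zero.mpr ⟨⟨x⟩, inferInstance⟩
  have hidx : (MulAction.stabilizer (Aut FG) (show FG.obj A from x₀)).index =
      (MulAction.stabilizer (Aut FG) x).index := by
    rw [MulAction.index_stabilizer_of_transitive, MulAction.index_stabilizer_of_transitive]
  have hge : MulAction.stabilizer (Aut FG) x ≤ MulAction.stabilizer (Aut FG) (show FG.obj A from x₀) := by
    have h := Subgroup.relIndex_mul_index hle
    rw [hidx] at h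
    exact Subgroup.relIndex_eq_one.mp ((mul_eq_right₀ hne).mp h)
  -- `Π_ℍ` acts on the fibre of `A|_ℍ` through `Π_ℍ → Π_𝒢` (definitionally)
  intro σ hσ
  have hσ' : 𝒢.piHToPi H uH F₂ σ ∈ MulAction.stabilizer (Aut FG) x := hσ
  have hσ₀ : 𝒢.piHToPi H uH F₂ σ ∈ MulAction.stabilizer (Aut FG) (show FG.obj A from x₀) := hge hσ'
  exact key hσ₀

/-- **(D3) for branch-aligned coverings — [SemiAnbd] Cor. 2.7 (i) p. 30, "`ℋ′` injects into `𝒢′` as a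
subgraph", at print's notion of morphism (Def. 2.2 (i): local ∧ global ∧ vertex-aligned ∧
branch-aligned).**  For connected `𝒢`, `𝒢′` and `φ : 𝒢′ → 𝒢` locally and globally the covering
attached to `A`, vertex-aligned and branch-aligned: with `Π′ := ι(Π_{𝒢′}) = Stab(x₀)` and `Π_ℍ ≤ Π_𝒢`
the decomposition group of a connected sub-graph `ℍ`, (P1) the preimage components `K` of `ℍ`
correspond bijectively to the double cosets `Π_ℍ \ Π_𝒢 / Π′` via `K ↦ Π_ℍ d(K) Π′`, (P2) the component
through `v′` exists, (P3) it goes to the class of `Π′` with `ι(Π_{K₀}) = Π′ ∩ Π_ℍ`, (P4) at every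
vertex of every component `ι(Π_K) = Π′ ∩ g⁻¹ Π_ℍ g`.  (= the dictionary fact
`covering_subgraphComponents_doubleCosets` with the branch-alignment clause of print's Def. 2.2 (i)
added; proof: (ST) from `Hom.stabilizer_le_range_restrict_of_isBranchAligned` +
`Hom.range_restrict_le_stabilizer_of_range_le`, then
`covering_subgraphComponents_doubleCosets_body_of_stabilizers`.)
[cite: MochizukiSemiAnbd2006, Cor. 2.7(i) p.30] -/
theorem covering_subgraphComponents_doubleCosets_of_isBranchAligned :
    ∀ (𝒢 𝒢' : SemiGraphOfAnabelioids.{v₁, u₁, u}) (φ : Hom 𝒢' 𝒢) (A : 𝒢.BObj),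
      𝒢.IsConnected → 𝒢'.IsConnected → φ.IsFiniteEtaleCoveringOf A → φ.IsGlobalCoveringOf A →
      φ.IsVertexAligned → φ.IsBranchAligned →
      ∀ (v' : 𝒢'.graph.Vertex) (F' : 𝒢'.V v' ⥤ FintypeCat.{v₁}) [FiberFunctor F']
        (F : 𝒢.V (φ.base.vertexMap v') ⥤ FintypeCat.{v₁}) [FiberFunctor F]
        (e : (φ.φV v').pullback ⋙ F' ≅ F)
        (H : 𝒢.graph.Subgraph), H.toSemiGraph.IsConnected → H.toSemiGraph.IsGraph →
        ∀ (hv : φ.base.vertexMap v' ∈ H.verts),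
        let v := φ.base.vertexMap v'
        let ι : 𝒢'.Pi v' F' →* 𝒢.Pi v F :=
          (Aut.autMulEquivOfIso (Functor.isoWhiskerLeft (𝒢.ρ v) e)).toMonoidHom.comp
            (pi1Map φ.pullbackFunctor (𝒢'.ρ v' ⋙ F'))
        let PH : Subgroup (𝒢.Pi v F) := (𝒢.piHToPi H ⟨v, hv⟩ F).range
        ∀ x₀ : (𝒢.ρ v ⋙ F).obj A, ι.range = MulAction.stabilizer (𝒢.Pi v F) x₀ →
          ∃ d : {K : 𝒢'.graph.Subgraph // φ.IsPreimageComponent H K} → 𝒢.Pi v F,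
            Function.Bijective (fun K => DoubleCoset.mk PH ι.range (d K)) ∧
            (∃ K₀ : {K : 𝒢'.graph.Subgraph // φ.IsPreimageComponent H K}, v' ∈ K₀.1.verts) ∧
            (∀ (K : {K : 𝒢'.graph.Subgraph // φ.IsPreimageComponent H K}) (hK : v' ∈ K.1.verts),
              d K ∈ ι.range ∧ (ι.comp (𝒢'.piHToPi K.1 ⟨v', hK⟩ F')).range = ι.range ⊓ PH) ∧
            ∀ (K : {K : 𝒢'.graph.Subgraph // φ.IsPreimageComponent H K})
              (w'' : K.1.toSemiGraph.Vertex) (F'' : 𝒢'.V w''.1 ⥤ FintypeCat.{v₁}) [FiberFunctor F'']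
              (α : 𝒢'.ρ w''.1 ⋙ F'' ≅ 𝒢'.ρ v' ⋙ F'),
              ∃ g : 𝒢.Pi v F,
                (ι.comp ((Aut.autMulEquivOfIso α).toMonoidHom.comp (𝒢'.piHToPi K.1 w'' F''))).range =
                  ι.range ⊓ ConjAct.toConjAct g⁻¹ • PH := by
  intro 𝒢 𝒢' φ A h𝒢 h𝒢' hloc hB hva hal v' F' _ F _ e H hH hHg hv v ι PH x₀ hx₀
  refine covering_subgraphComponents_doubleCosets_body_of_stabilizers h𝒢 h𝒢' φ A hloc hB v' F' F e
    H hH hHg hv ?_ x₀ hx₀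
  intro K w'' F'' _ F₂ _ e₂
  -- the section point of the global clause: `ι″(Π_{𝒢′}) = Stab(a)`
  obtain ⟨a, -, ha⟩ := covering_decompositionGroup_of_isGlobalCoveringOf φ A hB w''.1 F'' F₂ e₂
  refine ⟨a, le_antisymm ?_ ?_, ha⟩
  · exact φ.range_restrict_le_stabilizer_of_range_le K.1 H K.2.2.2.2.1 K.2.2.2.2.2.1 w'' F'' F₂ e₂ A
      a ha.le
  · exact φ.stabilizer_le_range_restrict_of_isBranchAligned A h𝒢 h𝒢' hloc hB hva hal H hH hHg K w''
      F'' F₂ e₂ a ha.le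

end SemiGraphOfAnabelioids

end Literature.AnabelianGeometry.SemiGraphs
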